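import Summits.BirchSwinnertonDyer.BirchSwinnertonDyer.Theorems.ManinLocalTwoThreeBlindResidualEdges
import HarnessLib

/-!
# C2's WILD blind residual sharpened to the ORBIT-MINIMAL classes — skeleton v12 of `kato_shift_two` composed BY NAME

Summit `BirchSwinnertonDyer`, route `ManinLocalTwoThree` (cell bsd-f2-manin), crux C2 `ManinOddAtFour`
(stmt-BirchSwinnertonDyer-22967), line `kato_shift_two`.  v10 (lead p1 g4) had ONE blind stub carrying the five
twist-orbit-minimality clauses; v11 (planner-of-record, 11:09Z) replaced it by the NAMED pair
`RbTotallyBlindTame ∧ RbTotallyBlindWild` — all-named, but `RbTotallyBlindWild` quantifies over EVERY totally blind optimal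
curve with `8 ∣ N`, including the infinite family of `χ₋₁`-twists `E′_m`, `m ≡ 3 (4)`, at `N = 16(m² + 4)` (31 classes
`< 5·10⁵`), which the line's Kato-shift transport already derives from the orbit-minimal member at `4(m² + 4)` (clause 3
of v10's stub excludes them).  THIS FILE (lead p1 g5) restores the sharpness while keeping the tame half named:

* `exists_datum_smul_blindData` — plumbing: along a `u = 1` change to an integral `a₁ = a₃ = 0` model with an integral
  `2`-torsion abscissa and all integral abscissae Kummer-blind, the datum transports (`c` unchanged, p620514) and the
  model satisfies `HasRationalTwoTorsion ∧ AllRationalTwoTorsionBlind` (rational roots are integral);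
* **WILD-OM** (inline; typing ask T-p1-g5-2: leaf `RbTotallyBlindWildOrbitMinimal` in `OddDegreeTooth.lean`) := v10's
  blind stub VERBATIM with `2³ ∣ N` in place of `2² ∣ N` — the totally blind, ORBIT-MINIMAL, WILD optimal classes
  (in Cremona's range: 32a1, 128b1, 128d1 only; conjecturally nothing else, imc E-imc-29);
* `wildOrbitMinimal_of_rbTotallyBlindWild : RbTotallyBlindWild → WILD-OM` (the v12 stub is WEAKER than v11's);
* `blindOrbitMinimalResidual_of_rbTotallyBlindTame_of_wildOrbitMinimal : RbTotallyBlindTame → WILD-OM → v10 stub 6c`;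
* the v12 COMPOSITIONS `maninOddAtFour_of_…_of_blindTame_of_wildOrbitMinimal` (F♯ ∧ E-an-48 ∧ E-an-53 ∧ Tame ∧ WILD-OM)
  and `maninOddAtFour_of_…_of_cns_of_oddDegree_of_wildOrbitMinimal` (F♯ ∧ E-an-48 ∧ E-an-53 ∧ ČNS ∧ E-an-73 ∧ WILD-OM).

CONDITIONAL edges only; nothing about BSD or Manin's conjecture is proved. [folklore]
-/

set_option autoImplicit false
set_option linter.dupNamespace false

noncomputable section

open scoped Classical MatrixGroups ModularForm
open PowerSeries CongruenceSubgroup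
open WeierstrassCurve Literature.NumberTheory.EllipticCurves Literature.NumberTheory.EllipticCurves.ModularForms
open Summit.BirchSwinnertonDyer.Rank1Residual.ManinAdditive
open Summit.BirchSwinnertonDyer.Rank1Residual.ManinAdditive.CuspidalKummer
open Summit.BirchSwinnertonDyer.Rank1Residual.ManinAdditive.ShimuraLedger
open Summit.BirchSwinnertonDyer.Rank1Residual.ManinAdditive.OddDegreeTooth

namespace Summit.BirchSwinnertonDyer.BirchSwinnertonDyer.Theorems.ManinLocalTwoThree

/-- **Plumbing.**  Along a `u = 1` change `C` to an integral model `M` with `a₁ = a₃ = 0`, an `X₀(N)`-datum of `W`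
transports to `C • W` with the same `f`, `c` and lattice (p620514), `C • W` has `a₁ = a₃ = 0`, an integral
`2`-torsion abscissa gives `HasRationalTwoTorsion`, and «all integral abscissae blind» gives
`AllRationalTwoTorsionBlind` (rational roots of the monic integral `2`-division cubic are integral). [folklore] -/
theorem exists_datum_smul_blindData (W : WeierstrassCurve ℚ) [W.IsElliptic] [W.IsGloballyMinimal] {N : ℕ} [NeZero N]
    (D : ModularParametrizationData W N) (hopt : ∀ z ∈ D.L.lattice, ∃ w ∈ periodLattice D.f, z = D.c * w)
    (C : VariableChange ℚ) (M : WeierstrassCurve ℤ) (hu : C.u = 1) (hCW : C • W = M.map (Int.castRingHom ℚ))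
    (hM1 : M.a₁ = 0) (hM3 : M.a₃ = 0)
    (hex : ∃ e : ℤ, (C • W).twoTorsionPolynomial.toPoly.IsRoot (e : ℚ))
    (hall : ∀ e : ℤ, (C • W).twoTorsionPolynomial.toPoly.IsRoot (e : ℚ) → KummerBlindAtTwo M.a₂ M.a₄ e) :
    ∃ D' : ModularParametrizationData (C • W) N,
      (∀ z ∈ D'.L.lattice, ∃ w ∈ periodLattice D'.f, z = D'.c * w) ∧ D'.c = D.c ∧
      (C • W).a₁ = 0 ∧ (C • W).a₃ = 0 ∧ HasRationalTwoTorsion (C • W) ∧ AllRationalTwoTorsionBlind (C • W) := by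
  obtain ⟨D', hf, hc, hL, -⟩ := exists_modularParametrizationData_smul_of_u_eq_one W D C hu
  have hopt' : ∀ z ∈ D'.L.lattice, ∃ w ∈ periodLattice D'.f, z = D'.c * w := by
    rw [hL, hf, hc]; exact hopt
  have ha₁ : (C • W).a₁ = 0 := by rw [hCW, map_a₁, hM1, map_zero]
  have ha₃ : (C • W).a₃ = 0 := by rw [hCW, map_a₃, hM3, map_zero]
  have ha₂ : (C • W).a₂ = (M.a₂ : ℚ) := by rw [hCW, map_a₂, eq_intCast]
  have ha₄ : (C • W).a₄ = (M.a₄ : ℚ) := by rw [hCW, map_a₄, eq_intCast]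
  refine ⟨D', hopt', hc, ha₁, ha₃, ?_, ?_⟩
  · obtain ⟨e, he⟩ := hex
    exact ⟨(e : ℚ), (isRoot_twoTorsionPolynomial_iff_of_a₁_a₃ (C • W) ha₁ ha₃ _).mp he⟩
  · intro e he
    have he' : (C • W).twoTorsionPolynomial.toPoly.IsRoot e :=
      (isRoot_twoTorsionPolynomial_iff_of_a₁_a₃ (C • W) ha₁ ha₃ e).mpr he
    have heM : (M.map (Int.castRingHom ℚ)).twoTorsionPolynomial.toPoly.IsRoot e := by rw [← hCW]; exact he'
    obtain ⟨E, rfl⟩ := exists_intCast_eq_of_isRoot_twoTorsionPolynomial M hM1 hM3 heM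
    exact ⟨M.a₂, M.a₄, E, ha₂.symm, ha₄.symm, rfl, hall E he'⟩

/-- **`RbTotallyBlindWild ⟹ WILD-OM`**: the orbit-minimal wild blind residual (v10's blind stub with `2³ ∣ N`, stated
inline) is implied by an's `RbTotallyBlindWild` (drop the five orbit-minimality clauses; transport along the `u = 1` model
change).  So v12's stub is weaker than v11's. [folklore] -/
theorem wildOrbitMinimal_of_rbTotallyBlindWild (hw : RbTotallyBlindWild) :
    ∀ (W : WeierstrassCurve ℚ) [W.IsElliptic] [W.IsGloballyMinimal] {N : ℕ} [NeZero N]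
      (D : ModularParametrizationData W N),
      (∀ z ∈ D.L.lattice, ∃ w ∈ periodLattice D.f, z = D.c * w) → 2 ^ 3 ∣ N →
      ¬ (∃ (W' : WeierstrassCurve ℚ) (d : ℤ), W'.IsElliptic ∧ W'.IsGloballyMinimal ∧
        (d = -1 ∨ d = 2 ∨ d = -2) ∧ IsIsogenous W (W'.quadraticTwist (d : ℚ)) ∧
        ¬ 2 ^ 2 ∣ W'.conductorNorm ℤ) →
      ¬ (∃ (W' : WeierstrassCurve ℚ) (q : ℕ), W'.IsElliptic ∧ W'.IsGloballyMinimal ∧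
        q.Prime ∧ q ≠ 2 ∧ q ^ 2 ∣ N ∧
        IsIsogenous W (W'.quadraticTwist (((-1 : ℤ) ^ (q / 2) * q : ℤ) : ℚ)) ∧
        ¬ q ^ 2 ∣ W'.conductorNorm ℤ) →
      ¬ (∃ (A : WeierstrassCurve ℚ), A.IsElliptic ∧ A.IsGloballyMinimal ∧ 2 ^ 4 ∣ N ∧
        2 ^ 2 ∣ A.conductorNorm ℤ ∧ A.conductorNorm ℤ ∣ N ∧ A.conductorNorm ℤ < N ∧
        IsIsogenous W (A.quadraticTwist ((-1 : ℤ) : ℚ))) →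
      ¬ (∃ (A : WeierstrassCurve ℚ) (_ : A.IsElliptic) (_ : A.IsGloballyMinimal) (N' : ℕ) (_ : NeZero N')
        (D' : ModularParametrizationData A N') (d : ℤ) (C : WeierstrassCurve ℚ) (u : VariableChange ℚ),
        C.IsElliptic ∧ C.IsGloballyMinimal ∧
        (∀ z ∈ D'.L.lattice, ∃ w ∈ periodLattice D'.f, z = D'.c * w) ∧ (d = 2 ∨ d = -2) ∧ 2 ^ 6 ∣ N ∧
        2 ^ 2 ∣ A.conductorNorm ℤ ∧ A.conductorNorm ℤ ∣ N ∧
        IsIsogenous W (A.quadraticTwist (d : ℚ)) ∧ u • A.quadraticTwist (d : ℚ) = C ∧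
        C.Δ = (d : ℚ) ^ 6 * A.Δ ∧
        (A.conductorNorm ℤ < N ∨ A.minimalDiscriminantInt.natAbs < W.minimalDiscriminantInt.natAbs)) →
      ¬ (∃ (A : WeierstrassCurve ℚ) (_ : A.IsElliptic) (_ : A.IsGloballyMinimal)
        (D' : ModularParametrizationData A N) (q : ℕ) (C : WeierstrassCurve ℚ) (u : VariableChange ℚ),
        C.IsElliptic ∧ C.IsGloballyMinimal ∧
        (∀ z ∈ D'.L.lattice, ∃ w ∈ periodLattice D'.f, z = D'.c * w) ∧ q.Prime ∧ q ≠ 2 ∧ q ^ 2 ∣ N ∧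
        IsIsogenous C W ∧ u • A.quadraticTwist (((-1 : ℤ) ^ (q / 2) * q : ℤ) : ℚ) = C ∧
        C.Δ = ((((-1 : ℤ) ^ (q / 2) * q : ℤ)) : ℚ) ^ 6 * A.Δ ∧
        A.minimalDiscriminantInt.natAbs < W.minimalDiscriminantInt.natAbs) →
      ∀ (C : VariableChange ℚ) (M : WeierstrassCurve ℤ), C.u = 1 → C • W = M.map (Int.castRingHom ℚ) →
        M.a₁ = 0 → M.a₃ = 0 → (C • W).IsGloballyMinimal →
        (∃ e : ℤ, (C • W).twoTorsionPolynomial.toPoly.IsRoot (e : ℚ)) →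
        (∀ e : ℤ, (C • W).twoTorsionPolynomial.toPoly.IsRoot (e : ℚ) → KummerBlindAtTwo M.a₂ M.a₄ e) →
        ¬ (2 : ℤ) ∣ D.c := by
  intro W _ _ N _ D hopt h8 _ _ _ _ _ C M hu hCW hM1 hM3 hmin hex hall
  haveI := hmin
  obtain ⟨D', hopt', hc, ha₁, ha₃, hT, hB⟩ := exists_datum_smul_blindData W D hopt C M hu hCW hM1 hM3 hex hall
  have h := hw (C • W) D' hopt' h8 ha₁ ha₃ hT hB
  change ¬ (2 : ℤ) ∣ D'.c at h
  rwa [hc] at h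

/-- **v10's blind stub from the NAMED tame residual and the orbit-minimal WILD residual**:
`RbTotallyBlindTame → WILD-OM → stub_blindOrbitMinimalResidual` (case `8 ∣ N`: WILD-OM verbatim; case `4 ∥ N`: transport
to the `a₁ = a₃ = 0` model and apply `RbTotallyBlindTame`). [folklore] -/
theorem blindOrbitMinimalResidual_of_rbTotallyBlindTame_of_wildOrbitMinimal (ht : RbTotallyBlindTame)
    (hw :
    ∀ (W : WeierstrassCurve ℚ) [W.IsElliptic] [W.IsGloballyMinimal] {N : ℕ} [NeZero N]
      (D : ModularParametrizationData W N),
      (∀ z ∈ D.L.lattice, ∃ w ∈ periodLattice D.f, z = D.c * w) → 2 ^ 3 ∣ N →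
      ¬ (∃ (W' : WeierstrassCurve ℚ) (d : ℤ), W'.IsElliptic ∧ W'.IsGloballyMinimal ∧
        (d = -1 ∨ d = 2 ∨ d = -2) ∧ IsIsogenous W (W'.quadraticTwist (d : ℚ)) ∧
        ¬ 2 ^ 2 ∣ W'.conductorNorm ℤ) →
      ¬ (∃ (W' : WeierstrassCurve ℚ) (q : ℕ), W'.IsElliptic ∧ W'.IsGloballyMinimal ∧
        q.Prime ∧ q ≠ 2 ∧ q ^ 2 ∣ N ∧
        IsIsogenous W (W'.quadraticTwist (((-1 : ℤ) ^ (q / 2) * q : ℤ) : ℚ)) ∧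
        ¬ q ^ 2 ∣ W'.conductorNorm ℤ) →
      ¬ (∃ (A : WeierstrassCurve ℚ), A.IsElliptic ∧ A.IsGloballyMinimal ∧ 2 ^ 4 ∣ N ∧
        2 ^ 2 ∣ A.conductorNorm ℤ ∧ A.conductorNorm ℤ ∣ N ∧ A.conductorNorm ℤ < N ∧
        IsIsogenous W (A.quadraticTwist ((-1 : ℤ) : ℚ))) →
      ¬ (∃ (A : WeierstrassCurve ℚ) (_ : A.IsElliptic) (_ : A.IsGloballyMinimal) (N' : ℕ) (_ : NeZero N')
        (D' : ModularParametrizationData A N') (d : ℤ) (C : WeierstrassCurve ℚ) (u : VariableChange ℚ),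
        C.IsElliptic ∧ C.IsGloballyMinimal ∧
        (∀ z ∈ D'.L.lattice, ∃ w ∈ periodLattice D'.f, z = D'.c * w) ∧ (d = 2 ∨ d = -2) ∧ 2 ^ 6 ∣ N ∧
        2 ^ 2 ∣ A.conductorNorm ℤ ∧ A.conductorNorm ℤ ∣ N ∧
        IsIsogenous W (A.quadraticTwist (d : ℚ)) ∧ u • A.quadraticTwist (d : ℚ) = C ∧
        C.Δ = (d : ℚ) ^ 6 * A.Δ ∧
        (A.conductorNorm ℤ < N ∨ A.minimalDiscriminantInt.natAbs < W.minimalDiscriminantInt.natAbs)) →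
      ¬ (∃ (A : WeierstrassCurve ℚ) (_ : A.IsElliptic) (_ : A.IsGloballyMinimal)
        (D' : ModularParametrizationData A N) (q : ℕ) (C : WeierstrassCurve ℚ) (u : VariableChange ℚ),
        C.IsElliptic ∧ C.IsGloballyMinimal ∧
        (∀ z ∈ D'.L.lattice, ∃ w ∈ periodLattice D'.f, z = D'.c * w) ∧ q.Prime ∧ q ≠ 2 ∧ q ^ 2 ∣ N ∧
        IsIsogenous C W ∧ u • A.quadraticTwist (((-1 : ℤ) ^ (q / 2) * q : ℤ) : ℚ) = C ∧
        C.Δ = ((((-1 : ℤ) ^ (q / 2) * q : ℤ)) : ℚ) ^ 6 * A.Δ ∧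
        A.minimalDiscriminantInt.natAbs < W.minimalDiscriminantInt.natAbs) →
      ∀ (C : VariableChange ℚ) (M : WeierstrassCurve ℤ), C.u = 1 → C • W = M.map (Int.castRingHom ℚ) →
        M.a₁ = 0 → M.a₃ = 0 → (C • W).IsGloballyMinimal →
        (∃ e : ℤ, (C • W).twoTorsionPolynomial.toPoly.IsRoot (e : ℚ)) →
        (∀ e : ℤ, (C • W).twoTorsionPolynomial.toPoly.IsRoot (e : ℚ) → KummerBlindAtTwo M.a₂ M.a₄ e) →
        ¬ (2 : ℤ) ∣ D.c) :
    ∀ (W : WeierstrassCurve ℚ) [W.IsElliptic] [W.IsGloballyMinimal] {N : ℕ} [NeZero N]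
      (D : ModularParametrizationData W N),
      (∀ z ∈ D.L.lattice, ∃ w ∈ periodLattice D.f, z = D.c * w) → 2 ^ 2 ∣ N →
      ¬ (∃ (W' : WeierstrassCurve ℚ) (d : ℤ), W'.IsElliptic ∧ W'.IsGloballyMinimal ∧
        (d = -1 ∨ d = 2 ∨ d = -2) ∧ IsIsogenous W (W'.quadraticTwist (d : ℚ)) ∧
        ¬ 2 ^ 2 ∣ W'.conductorNorm ℤ) →
      ¬ (∃ (W' : WeierstrassCurve ℚ) (q : ℕ), W'.IsElliptic ∧ W'.IsGloballyMinimal ∧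
        q.Prime ∧ q ≠ 2 ∧ q ^ 2 ∣ N ∧
        IsIsogenous W (W'.quadraticTwist (((-1 : ℤ) ^ (q / 2) * q : ℤ) : ℚ)) ∧
        ¬ q ^ 2 ∣ W'.conductorNorm ℤ) →
      ¬ (∃ (A : WeierstrassCurve ℚ), A.IsElliptic ∧ A.IsGloballyMinimal ∧ 2 ^ 4 ∣ N ∧
        2 ^ 2 ∣ A.conductorNorm ℤ ∧ A.conductorNorm ℤ ∣ N ∧ A.conductorNorm ℤ < N ∧
        IsIsogenous W (A.quadraticTwist ((-1 : ℤ) : ℚ))) →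
      ¬ (∃ (A : WeierstrassCurve ℚ) (_ : A.IsElliptic) (_ : A.IsGloballyMinimal) (N' : ℕ) (_ : NeZero N')
        (D' : ModularParametrizationData A N') (d : ℤ) (C : WeierstrassCurve ℚ) (u : VariableChange ℚ),
        C.IsElliptic ∧ C.IsGloballyMinimal ∧
        (∀ z ∈ D'.L.lattice, ∃ w ∈ periodLattice D'.f, z = D'.c * w) ∧ (d = 2 ∨ d = -2) ∧ 2 ^ 6 ∣ N ∧
        2 ^ 2 ∣ A.conductorNorm ℤ ∧ A.conductorNorm ℤ ∣ N ∧
        IsIsogenous W (A.quadraticTwist (d : ℚ)) ∧ u • A.quadraticTwist (d : ℚ) = C ∧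
        C.Δ = (d : ℚ) ^ 6 * A.Δ ∧
        (A.conductorNorm ℤ < N ∨ A.minimalDiscriminantInt.natAbs < W.minimalDiscriminantInt.natAbs)) →
      ¬ (∃ (A : WeierstrassCurve ℚ) (_ : A.IsElliptic) (_ : A.IsGloballyMinimal)
        (D' : ModularParametrizationData A N) (q : ℕ) (C : WeierstrassCurve ℚ) (u : VariableChange ℚ),
        C.IsElliptic ∧ C.IsGloballyMinimal ∧
        (∀ z ∈ D'.L.lattice, ∃ w ∈ periodLattice D'.f, z = D'.c * w) ∧ q.Prime ∧ q ≠ 2 ∧ q ^ 2 ∣ N ∧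
        IsIsogenous C W ∧ u • A.quadraticTwist (((-1 : ℤ) ^ (q / 2) * q : ℤ) : ℚ) = C ∧
        C.Δ = ((((-1 : ℤ) ^ (q / 2) * q : ℤ)) : ℚ) ^ 6 * A.Δ ∧
        A.minimalDiscriminantInt.natAbs < W.minimalDiscriminantInt.natAbs) →
      ∀ (C : VariableChange ℚ) (M : WeierstrassCurve ℤ), C.u = 1 → C • W = M.map (Int.castRingHom ℚ) →
        M.a₁ = 0 → M.a₃ = 0 → (C • W).IsGloballyMinimal →
        (∃ e : ℤ, (C • W).twoTorsionPolynomial.toPoly.IsRoot (e : ℚ)) →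
        (∀ e : ℤ, (C • W).twoTorsionPolynomial.toPoly.IsRoot (e : ℚ) → KummerBlindAtTwo M.a₂ M.a₄ e) →
        ¬ (2 : ℤ) ∣ D.c := by
  intro W _ _ N _ D hopt h4 c₁ c₂ c₃ c₄ c₅ C M hu hCW hM1 hM3 hmin hex hall
  by_cases h8 : 2 ^ 3 ∣ N
  · exact hw W D hopt h8 c₁ c₂ c₃ c₄ c₅ C M hu hCW hM1 hM3 hmin hex hall
  · haveI := hmin
    obtain ⟨D', hopt', hc, ha₁, ha₃, hT, hB⟩ := exists_datum_smul_blindData W D hopt C M hu hCW hM1 hM3 hex hall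
    have h := ht (C • W) D' hopt' h4 h8 ha₁ ha₃ hT hB
    change ¬ (2 : ℤ) ∣ D'.c at h
    rwa [hc] at h

/-- **C2 BY NAME from F♯, K_geo (E-an-48), E-an-53, the named TAME residual and the orbit-minimal WILD residual** —
skeleton v12 of `kato_shift_two` (ledger road for the tame half).  CONDITIONAL. [cite: Kato2004Asterisque, Thm. 9.7 (p. 189)] -/
theorem maninOddAtFour_of_katoFact_of_cuspidalKummer_of_blindTame_of_wildOrbitMinimal
    (hF : kato_neron_isIntegral_twistedSymbolSum_of_additive_two_real)
    (h48 : CuspidalKummerRepresentativeAtFour) (h53 : CuspidalKummerOddExponent) (ht : RbTotallyBlindTame)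
    (hw :
    ∀ (W : WeierstrassCurve ℚ) [W.IsElliptic] [W.IsGloballyMinimal] {N : ℕ} [NeZero N]
      (D : ModularParametrizationData W N),
      (∀ z ∈ D.L.lattice, ∃ w ∈ periodLattice D.f, z = D.c * w) → 2 ^ 3 ∣ N →
      ¬ (∃ (W' : WeierstrassCurve ℚ) (d : ℤ), W'.IsElliptic ∧ W'.IsGloballyMinimal ∧
        (d = -1 ∨ d = 2 ∨ d = -2) ∧ IsIsogenous W (W'.quadraticTwist (d : ℚ)) ∧
        ¬ 2 ^ 2 ∣ W'.conductorNorm ℤ) →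
      ¬ (∃ (W' : WeierstrassCurve ℚ) (q : ℕ), W'.IsElliptic ∧ W'.IsGloballyMinimal ∧
        q.Prime ∧ q ≠ 2 ∧ q ^ 2 ∣ N ∧
        IsIsogenous W (W'.quadraticTwist (((-1 : ℤ) ^ (q / 2) * q : ℤ) : ℚ)) ∧
        ¬ q ^ 2 ∣ W'.conductorNorm ℤ) →
      ¬ (∃ (A : WeierstrassCurve ℚ), A.IsElliptic ∧ A.IsGloballyMinimal ∧ 2 ^ 4 ∣ N ∧
        2 ^ 2 ∣ A.conductorNorm ℤ ∧ A.conductorNorm ℤ ∣ N ∧ A.conductorNorm ℤ < N ∧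
        IsIsogenous W (A.quadraticTwist ((-1 : ℤ) : ℚ))) →
      ¬ (∃ (A : WeierstrassCurve ℚ) (_ : A.IsElliptic) (_ : A.IsGloballyMinimal) (N' : ℕ) (_ : NeZero N')
        (D' : ModularParametrizationData A N') (d : ℤ) (C : WeierstrassCurve ℚ) (u : VariableChange ℚ),
        C.IsElliptic ∧ C.IsGloballyMinimal ∧
        (∀ z ∈ D'.L.lattice, ∃ w ∈ periodLattice D'.f, z = D'.c * w) ∧ (d = 2 ∨ d = -2) ∧ 2 ^ 6 ∣ N ∧
        2 ^ 2 ∣ A.conductorNorm ℤ ∧ A.conductorNorm ℤ ∣ N ∧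
        IsIsogenous W (A.quadraticTwist (d : ℚ)) ∧ u • A.quadraticTwist (d : ℚ) = C ∧
        C.Δ = (d : ℚ) ^ 6 * A.Δ ∧
        (A.conductorNorm ℤ < N ∨ A.minimalDiscriminantInt.natAbs < W.minimalDiscriminantInt.natAbs)) →
      ¬ (∃ (A : WeierstrassCurve ℚ) (_ : A.IsElliptic) (_ : A.IsGloballyMinimal)
        (D' : ModularParametrizationData A N) (q : ℕ) (C : WeierstrassCurve ℚ) (u : VariableChange ℚ),
        C.IsElliptic ∧ C.IsGloballyMinimal ∧
        (∀ z ∈ D'.L.lattice, ∃ w ∈ periodLattice D'.f, z = D'.c * w) ∧ q.Prime ∧ q ≠ 2 ∧ q ^ 2 ∣ N ∧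
        IsIsogenous C W ∧ u • A.quadraticTwist (((-1 : ℤ) ^ (q / 2) * q : ℤ) : ℚ) = C ∧
        C.Δ = ((((-1 : ℤ) ^ (q / 2) * q : ℤ)) : ℚ) ^ 6 * A.Δ ∧
        A.minimalDiscriminantInt.natAbs < W.minimalDiscriminantInt.natAbs) →
      ∀ (C : VariableChange ℚ) (M : WeierstrassCurve ℤ), C.u = 1 → C • W = M.map (Int.castRingHom ℚ) →
        M.a₁ = 0 → M.a₃ = 0 → (C • W).IsGloballyMinimal →
        (∃ e : ℤ, (C • W).twoTorsionPolynomial.toPoly.IsRoot (e : ℚ)) →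
        (∀ e : ℤ, (C • W).twoTorsionPolynomial.toPoly.IsRoot (e : ℚ) → KummerBlindAtTwo M.a₂ M.a₄ e) →
        ¬ (2 : ℤ) ∣ D.c) :
    Summit.BirchSwinnertonDyer.BirchSwinnertonDyer.Theses.ManinLocalTwoThree.ManinOddAtFour :=
  maninOddAtFour_of_katoFact_of_cuspidalKummer_of_blindOrbitMinimal hF h48 h53 ManinOddOfOddEtaExponent_holds
    (blindOrbitMinimalResidual_of_rbTotallyBlindTame_of_wildOrbitMinimal ht hw)

/-- **C2 BY NAME from F♯, K_geo (E-an-48), E-an-53, the printed ČNS bound (+ modularity), the tame parity law E-an-73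
and the orbit-minimal WILD residual** — skeleton v12 of `kato_shift_two` (ČNS road for the tame half).  CONDITIONAL.
[cite: CesnaviciusNeururerSaha2023, Thm. 1.2] [cite: Kato2004Asterisque, Thm. 9.7 (p. 189)] -/
theorem maninOddAtFour_of_katoFact_of_cuspidalKummer_of_cns_of_oddDegree_of_wildOrbitMinimal
    (hF : kato_neron_isIntegral_twistedSymbolSum_of_additive_two_real)
    (h48 : CuspidalKummerRepresentativeAtFour) (h53 : CuspidalKummerOddExponent)
    (hcns : cesnaviciusNeururerSaha_thm_1_2) (hnf : exists_isNewformOf) (h73 : BlindTameOptimalOddDegree)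
    (hw :
    ∀ (W : WeierstrassCurve ℚ) [W.IsElliptic] [W.IsGloballyMinimal] {N : ℕ} [NeZero N]
      (D : ModularParametrizationData W N),
      (∀ z ∈ D.L.lattice, ∃ w ∈ periodLattice D.f, z = D.c * w) → 2 ^ 3 ∣ N →
      ¬ (∃ (W' : WeierstrassCurve ℚ) (d : ℤ), W'.IsElliptic ∧ W'.IsGloballyMinimal ∧
        (d = -1 ∨ d = 2 ∨ d = -2) ∧ IsIsogenous W (W'.quadraticTwist (d : ℚ)) ∧
        ¬ 2 ^ 2 ∣ W'.conductorNorm ℤ) →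
      ¬ (∃ (W' : WeierstrassCurve ℚ) (q : ℕ), W'.IsElliptic ∧ W'.IsGloballyMinimal ∧
        q.Prime ∧ q ≠ 2 ∧ q ^ 2 ∣ N ∧
        IsIsogenous W (W'.quadraticTwist (((-1 : ℤ) ^ (q / 2) * q : ℤ) : ℚ)) ∧
        ¬ q ^ 2 ∣ W'.conductorNorm ℤ) →
      ¬ (∃ (A : WeierstrassCurve ℚ), A.IsElliptic ∧ A.IsGloballyMinimal ∧ 2 ^ 4 ∣ N ∧
        2 ^ 2 ∣ A.conductorNorm ℤ ∧ A.conductorNorm ℤ ∣ N ∧ A.conductorNorm ℤ < N ∧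
        IsIsogenous W (A.quadraticTwist ((-1 : ℤ) : ℚ))) →
      ¬ (∃ (A : WeierstrassCurve ℚ) (_ : A.IsElliptic) (_ : A.IsGloballyMinimal) (N' : ℕ) (_ : NeZero N')
        (D' : ModularParametrizationData A N') (d : ℤ) (C : WeierstrassCurve ℚ) (u : VariableChange ℚ),
        C.IsElliptic ∧ C.IsGloballyMinimal ∧
        (∀ z ∈ D'.L.lattice, ∃ w ∈ periodLattice D'.f, z = D'.c * w) ∧ (d = 2 ∨ d = -2) ∧ 2 ^ 6 ∣ N ∧
        2 ^ 2 ∣ A.conductorNorm ℤ ∧ A.conductorNorm ℤ ∣ N ∧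
        IsIsogenous W (A.quadraticTwist (d : ℚ)) ∧ u • A.quadraticTwist (d : ℚ) = C ∧
        C.Δ = (d : ℚ) ^ 6 * A.Δ ∧
        (A.conductorNorm ℤ < N ∨ A.minimalDiscriminantInt.natAbs < W.minimalDiscriminantInt.natAbs)) →
      ¬ (∃ (A : WeierstrassCurve ℚ) (_ : A.IsElliptic) (_ : A.IsGloballyMinimal)
        (D' : ModularParametrizationData A N) (q : ℕ) (C : WeierstrassCurve ℚ) (u : VariableChange ℚ),
        C.IsElliptic ∧ C.IsGloballyMinimal ∧
        (∀ z ∈ D'.L.lattice, ∃ w ∈ periodLattice D'.f, z = D'.c * w) ∧ q.Prime ∧ q ≠ 2 ∧ q ^ 2 ∣ N ∧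
        IsIsogenous C W ∧ u • A.quadraticTwist (((-1 : ℤ) ^ (q / 2) * q : ℤ) : ℚ) = C ∧
        C.Δ = ((((-1 : ℤ) ^ (q / 2) * q : ℤ)) : ℚ) ^ 6 * A.Δ ∧
        A.minimalDiscriminantInt.natAbs < W.minimalDiscriminantInt.natAbs) →
      ∀ (C : VariableChange ℚ) (M : WeierstrassCurve ℤ), C.u = 1 → C • W = M.map (Int.castRingHom ℚ) →
        M.a₁ = 0 → M.a₃ = 0 → (C • W).IsGloballyMinimal →
        (∃ e : ℤ, (C • W).twoTorsionPolynomial.toPoly.IsRoot (e : ℚ)) →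
        (∀ e : ℤ, (C • W).twoTorsionPolynomial.toPoly.IsRoot (e : ℚ) → KummerBlindAtTwo M.a₂ M.a₄ e) →
        ¬ (2 : ℤ) ∣ D.c) :
    Summit.BirchSwinnertonDyer.BirchSwinnertonDyer.Theses.ManinLocalTwoThree.ManinOddAtFour :=
  maninOddAtFour_of_katoFact_of_cuspidalKummer_of_blindTame_of_wildOrbitMinimal hF h48 h53
    (rbTotallyBlindTame_of_cns_of_blindTameOptimalOddDegree hcns hnf h73) hw

end Summit.BirchSwinnertonDyer.BirchSwinnertonDyer.Theorems.ManinLocalTwoThree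

end
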